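import Literature.Probability.LatticeModels.LatticePotentialKernelAsymptotics
import Literature.Probability.LatticeModels.LatticePotentialKernelDiagonal
import HarnessLib

/-!
# The constant of the planar potential kernel: `a(x) = (1/π) log |x| + (2γ + 3 log 2)/(2π) + o(1)`

Topic `Literature/Probability/LatticeModels`; the two-line synthesis of
`LatticePotentialKernelAsymptotics.lean` (Lawler–Limic 2010, Thm. 4.4.4 in the tree's normalisation
`Δ a = 2δ₀`: `a(x) - (2π)⁻¹ log(x₀² + x₁²) → κ` along the cofinite filter of `ℤ²`, for SOME `κ`)
and `LatticePotentialKernelDiagonal.lean` (the exact diagonal values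
`a(n,n) = (2/π) Σ_{k<n} 1/(2k+1)`, whence `|a(n,n) - (1/π) log |(n,n)| - k₀/2| ≤ 2/(πn)` with
`k₀ = KozdronLawler.greenConst = (2γ + 3 log 2)/π`): the limit `κ` IS `k₀/2`, by uniqueness of
limits along the diagonal. This is the constant "`k₀ = (2ς + 3 ln 2)/π`" of Kozdron–Lawler 2005,
§2.3 eq. (16), `a_{KL}(x) = (2/π) log|x| + k₀ + o(1)` for `a_{KL} = 2a` — the potential-kernel input
of the printed proof of their Theorem 1.2 (`GreenFunctionConformalRadius.lean`).

* `latticePotentialKernel_two_tendsto_greenConst` — `a(x) - (2π)⁻¹ log(x₀² + x₁²) → k₀/2`;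
* `latticePotentialKernel_two_tendsto_greenConst'` — the same with `(1/π) log ‖x‖`
  (`‖x‖` = modulus of `Site.toComplex x`), the form consumed by Kozdron–Lawler.

No rate is claimed (the business of a quantitative version of Thm. 4.4.4); no named fact.

## References

* G. F. Lawler, V. Limic, *Random Walk: A Modern Introduction* (2010), Thm. 4.4.4
  (`a(x) = (2/π) log|x| + (2γ + log 8)/π + O(|x|⁻²)`) [LawlerLimic2010].
* M. J. Kozdron, G. F. Lawler, Electron. J. Probab. 10 (2005), §2.3 eq. (16) [KozdronLawler2005].
-/

noncomputable section

open Filter Set Real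
open _root_.Topology

namespace Literature.Probability.LatticeModels

/-- The diagonal `n ↦ (n, n)` tends to infinity in `ℤ²` (it is injective). [folklore] -/
theorem tendsto_diag_cofinite :
    Tendsto (fun n : ℕ => (fun _ : Fin 2 => ((n : ℕ) : ℤ)) : ℕ → Site 2) atTop cofinite := by
  have hinj : Function.Injective (fun n : ℕ => (fun _ : Fin 2 => ((n : ℕ) : ℤ)) : ℕ → Site 2) := by
    intro m n h
    have h0 : ((m : ℕ) : ℤ) = ((n : ℕ) : ℤ) := congrFun h 0
    exact_mod_cast h0
  rw [← Nat.cofinite_eq_atTop]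
  exact hinj.tendsto_cofinite

/-- On the diagonal, `(2π)⁻¹ log(n² + n²) = (1/π) log |(n,n)|` (`|(n,n)| = n√2`, `n ≥ 1`).
[folklore] -/
theorem inv_two_pi_mul_log_diag {n : ℕ} (hn : 1 ≤ n) :
    (2 * π)⁻¹ * Real.log ((((n : ℕ) : ℤ) : ℝ) ^ 2 + (((n : ℕ) : ℤ) : ℝ) ^ 2) =
      1 / π * Real.log ‖Site.toComplex (fun _ : Fin 2 => ((n : ℕ) : ℤ))‖ := by
  have hn0 : (0 : ℝ) < n := by exact_mod_cast hn
  rw [PotentialKernelDiagonal.norm_toComplex_diag]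
  have h2 : (((n : ℕ) : ℤ) : ℝ) ^ 2 + (((n : ℕ) : ℤ) : ℝ) ^ 2 = (n * Real.sqrt 2) ^ 2 := by
    push_cast
    rw [mul_pow, Real.sq_sqrt (by norm_num : (0 : ℝ) ≤ 2)]
    ring
  rw [h2, Real.log_pow]
  push_cast
  field_simp

/-- **The constant of the planar potential kernel** (Lawler–Limic 2010, Thm. 4.4.4; Kozdron–Lawler
2005, eq. (16), in the normalisation `Δ a = 2δ₀`): `a(x) - (2π)⁻¹ log (x₀² + x₁²) → k₀/2` as
`x → ∞` in `ℤ²`, with `k₀ = (2γ + 3 log 2)/π` (`KozdronLawler.greenConst`), i.e.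
`a(x) = (1/π) log |x| + (2γ + 3 log 2)/(2π) + o(1)`. [cite: LawlerLimic2010, Thm. 4.4.4] -/
theorem latticePotentialKernel_two_tendsto_greenConst :
    Tendsto (fun x : Site 2 => latticePotentialKernel 2 x -
      (2 * π)⁻¹ * Real.log (((x 0 : ℤ) : ℝ) ^ 2 + ((x 1 : ℤ) : ℝ) ^ 2)) cofinite
      (𝓝 (KozdronLawler.greenConst / 2)) := by
  obtain ⟨κ, hκ⟩ := latticePotentialKernel_two_asymptotics
  -- along the diagonal the same sequence converges to `κ` and to `k₀/2`
  have h1 := hκ.comp tendsto_diag_cofinite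
  have h2 : Tendsto ((fun x : Site 2 => latticePotentialKernel 2 x -
      (2 * π)⁻¹ * Real.log (((x 0 : ℤ) : ℝ) ^ 2 + ((x 1 : ℤ) : ℝ) ^ 2)) ∘
        (fun n : ℕ => (fun _ : Fin 2 => ((n : ℕ) : ℤ)) : ℕ → Site 2)) atTop
      (𝓝 (KozdronLawler.greenConst / 2)) := by
    rw [tendsto_iff_norm_sub_tendsto_zero]
    have hbound : Tendsto (fun n : ℕ => 2 / (π * n)) atTop (𝓝 0) := by
      have h : Tendsto (fun n : ℕ => π * (n : ℝ)) atTop atTop :=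
        Tendsto.const_mul_atTop Real.pi_pos tendsto_natCast_atTop_atTop
      exact h.const_div_atTop 2
    refine squeeze_zero' (Eventually.of_forall fun n => norm_nonneg _) ?_ hbound
    filter_upwards [eventually_ge_atTop 1] with n hn
    rw [Function.comp_apply, Real.norm_eq_abs]
    simp only
    rw [inv_two_pi_mul_log_diag hn]
    exact PotentialKernelDiagonal.abs_latticePotentialKernel_diagonal_sub_log_sub_le hn
  have heq : κ = KozdronLawler.greenConst / 2 := tendsto_nhds_unique h1 h2
  rw [← heq]
  exact hκ

/-- `x₀² + x₁² = ‖x‖²` for the planar embedding `Site.toComplex`. [folklore] -/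
theorem sq_add_sq_eq_norm_toComplex_sq (x : Site 2) :
    ((x 0 : ℤ) : ℝ) ^ 2 + ((x 1 : ℤ) : ℝ) ^ 2 = ‖Site.toComplex x‖ ^ 2 := by
  rw [Complex.sq_norm, Complex.normSq_apply, Site.toComplex_re, Site.toComplex_im]
  ring

/-- **The same in modulus form**: `a(x) - (1/π) log ‖x‖ → (2γ + 3 log 2)/(2π)` as `x → ∞` in
`ℤ²` (`‖x‖` the modulus of `Site.toComplex x`) — Kozdron–Lawler's (16),
"`a(x) = (2/π) log |x| + k₀ + o(1)`, `k₀ = (2ς + 3 ln 2)/π`", for their `a = 2 ·` ours.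
[cite: KozdronLawler2005, §2.3 eq. (16)] -/
theorem latticePotentialKernel_two_tendsto_greenConst' :
    Tendsto (fun x : Site 2 => latticePotentialKernel 2 x - 1 / π * Real.log ‖Site.toComplex x‖)
      cofinite (𝓝 (KozdronLawler.greenConst / 2)) := by
  refine (latticePotentialKernel_two_tendsto_greenConst).congr' ?_
  -- off the origin the two centring terms agree
  have hfin : Set.Finite {x : Site 2 | x = 0} := by
    simp only [setOf_eq_eq_singleton]
    exact finite_singleton 0
  filter_upwards [hfin.compl_mem_cofinite] with x hx
  simp only [mem_compl_iff, mem_setOf_eq] at hx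
  rw [sq_add_sq_eq_norm_toComplex_sq, Real.log_pow]
  have hne : Site.toComplex x ≠ 0 := by
    intro h
    apply hx
    ext i
    fin_cases i
    · have := congrArg Complex.re h; simpa using this
    · have := congrArg Complex.im h; simpa using this
  push_cast
  field_simp

end Literature.Probability.LatticeModels

end
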